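import Summits.CriticalPhenomena.PercolationContinuityZ3.Theses.PercNecklaceBackbone

/-!
# Birth skeleton (BC3) for the crux `NoBackbone` (stmt-CriticalPhenomena-5268)

Route `route-CriticalPhenomena-PercNecklaceBackbone` (sub-problem `PercolationContinuityZ3`), crux decl
`Summit.CriticalPhenomena.PercolationContinuityZ3.Theses.PercNecklaceBackbone.NoBackbone` (rank 2):
at `p = p_c(ℤ³)`, `Q(p_c) := P{ω | ∀ e, ω ∖ {e} ∈ {|C(0)| = ∞}} = 0` — almost surely some single edge
closure disconnects the origin from infinity (no two edge-disjoint open routes to infinity; the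
Chayes–Chayes backbone density vanishes at criticality).

THE LINE — "critical two-route decay by surface domination, with an exponent budget".
Work at the single measure `P = P_{p_c(ℤ³)}` on `ℤ³` and in finite volume (no supercritical
uniformity, no semicontinuity: contrast the route's rank-3 engine `BackboneBelowSurface`, which compares
`Q(p)` with `θ_ℍ(p)` for all `p > p_c`). Two finite-size functions of the scale `r ≥ 1` (sup-norm):

* the cut-form TWO-ROUTE function `Q_r := P(twoRoute r)`,
  `twoRoute r = {ω | ∀ e, ∃ y, ‖y‖∞ ≥ r ∧ 0 ↔ y in ω ∖ {e}}` ("after any single-edge deletion the origin is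
  still joined to sup-distance `r`"; by Menger this is "two edge-disjoint open routes from `0` to distance
  `r`", not needed here). `{∀ e, ω∖{e} ∈ {|C(0)| = ∞}} ⊆ twoRoute r` for every `r` (an infinite cluster
  leaves every box), so `Q(p_c) ≤ Q_r` — PROVED below (`backboneEvent_subset_twoRoute`), pure set theory.
* the HALF-SPACE ONE-ARM function `π_r := P(halfReach r)`,
  `halfReach r = {ω | ∃ y, ‖y‖∞ ≥ r ∧ 0 ↔ y inside ℍ}`, `ℍ = {x | 0 ≤ x₀}` — VERBATIM the event `armH r` of
  the crux `QuantitativeBGN` (stmt-CriticalPhenomena-0913, routes PercLowPointHalfSpace / PercPorousCritical /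
  PercFoamCut / PercPortalLadder / PercLayerChain) and of its landed Negative lane
  (`Theorems/QuantitativeBGN/Negative/{ArmLowerBound,LoadBearing}.lean`: `armH`, `armH_lower_bound`
  `π_{n+1} ≥ 1/(588 (n+1)²)`, `tendsto_armH_criticalProb` `π_r → 0`, proved from the tree's
  Barsky–Grimmett–Newman theorem `BarskyGrimmettNewman1991_Z3_holds`).

Two registered stubs, coupled ONLY through the exponent budget `κ < 1/2 ≤ a`:

* STUB 1 `stub_surfaceDomination` (XL, OPEN — the comparison): **lossy surface domination of the
  critical two-route function** — `∃ κ < 1/2, C : ∀ r ≥ 1, Q_r ≤ C · r^κ · π_r`: two edge-disjoint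
  critical routes to distance `r` in the full space cost, up to a polynomial LOSS `r^κ` with `κ < 1/2`,
  at least one route to distance `r` in the half-space. Scaling picture (real world): `Q_r ≈ r^{-x_B}`,
  `x_B = d − d_B ≈ 1.13` (monochromatic two-arm / backbone codimension, `d_B(3D) ≈ 1.87`,
  doi:10.1103/physreve.70.046106), `π_r ≈ r^{-x_s}`, `x_s ≈ 0.975` (Deng–Blöte 2005,
  doi:10.1103/PhysRevE.71.016117; tree Monte Carlo `0.95–0.98`, `Cruxes/QuantitativeBGN/Disproof.lean`,
  kit job j015616): the true loss exponent is `x_s − x_B ≈ −0.16 < 0`, margin `≈ 0.66` to the budget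
  line `1/2`. In the route's language it is the finite-size, same-`p` form of "a backbone vertex makes,
  with polynomial loss, a half-space percolation point" (rank 3). FALSE in a backboned jump world
  (`Q_r → Q(p_c) > 0` while `π_r → 0`), exactly like the crux; a bet in a necklace jump world.
* STUB 2 `stub_halfSpaceArmExponent` (XL, OPEN — the rate): **quantitative Barsky–Grimmett–Newman with
  exponent at least `1/2`** — `∃ a ≥ 1/2, C : ∀ r ≥ 1, π_r ≤ C · r^{-a}`. It implies `QuantitativeBGN`
  (`∃ a > 0`, stmt-CriticalPhenomena-0913) and is implied by `QuantitativeBGNWith a` for any `a ≥ 1/2`;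
  the landed tightness lemma `not_quantitativeBGNWith_of_two_lt` leaves the admissible window
  `1/2 ≤ a ≤ 2`, and numerically `a = x_s ≈ 0.96–0.98` (margin `≈ 0.47`). OPEN: BGN is qualitative
  (Grimmett 1999 Thm (7.35); Kozma–Nitzan 2024 §1(4): no rate in print; half-space rates only for `d > 6`,
  arXiv:1810.03750).
* Budget: `Q(p_c) ≤ Q_r ≤ C₁ r^κ π_r ≤ C₁ C₂ r^{κ−a}` and `κ − a < 0`, so `r → ∞` gives `Q(p_c) ≤ 0`.
  Neither stub alone gives the crux: STUB 2 says nothing about two routes; STUB 1 with `κ > 0` allowed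
  does not combine with the qualitative limit `π_r → 0` (in tree) — the line deliberately PAYS a BGN
  rate `a ≥ 1/2` for the weaker, lossy comparison `κ < 1/2` (any other split `κ < κ₀ ≤ a`,
  `κ₀ ∈ (x_s − x_B, x_s) ≈ (−0.16, 0.97)`, composes identically; `1/2` balances the two numerical
  margins). Design note: the lossless/power form `Q_r ≤ C π_r^b` (`b > 0`) would need only the in-tree
  qualitative limit, and would then carry the whole crux alone — that one-stub line is not registered.

Composition (kernel-checked, no `sorry`): `NoBackbone_of : stub_surfaceDomination →
stub_halfSpaceArmExponent → NoBackbone` (hypotheses typed by the name-keyed aliases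
`__Registered.stub_*`, the device of `Cruxes/BGNOffTheFloor/Lines/birth.lean`), via the proved plumbing
`backboneEvent_subset_twoRoute` (compactness: an infinite open cluster is not inside the finite box
`{‖y‖∞ < r}`), `real_backbone_le_twoRoute`, the `rpow` algebra `r^κ · r^{-a} = r^{-(a−κ)}` and
`tendsto_rpow_neg_atTop`.

DISPROOF USED: none exists for this crux (`ledger crux ls stmt-CriticalPhenomena-5268`: no workfiles, no
`Disproof.lean`, no landed Negative lemma, 2026-08-17). Checked instead against the Negative lane of the
NEIGHBOURING crux `QuantitativeBGN` whose event STUB 2 shares: `quantitativeBGN_false_without_rPos` (the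
guard `1 ≤ r` is kept in both stubs: at `r = 0`, `π_0 = 1` and `0^{-a} = 0`), `not_quantitativeBGNWith_of_two_lt`
(STUB 2 asks `a ≥ 1/2`, inside the window `(0, 2]`), `not_uniform_above` / `quantitativeBGNAt_false_of_theta_pos`
(both stubs are stated AT `p_c` only — no uniformity in `p`). Negatives index of the summit (11 entries,
2026-08-17): nothing on half-space arms or two-route events.
-/

noncomputable section

namespace Summit.CriticalPhenomena.PercolationContinuityZ3.Cruxes.NoBackbone.Birth

open MeasureTheory Filter Literature.Probability.Percolation Literature.Probability.LatticeModels
open scoped Topology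
open Summit.CriticalPhenomena.PercolationContinuityZ3.Theses.PercNecklaceBackbone (NoBackbone)

/-! ## Objects of the line -/

/-- The critical bond percolation measure `P_{p_c(ℤ³)}` on `ℤ³`. -/
abbrev μc : Measure (BondConfig (Site 3)) := bondPercolation (zdGraph 3) (criticalProbI 3)

/-- The crux event (cut form): after every single-edge deletion the origin still percolates. -/
def backboneEvent : Set (BondConfig (Site 3)) :=
  {ω | ∀ e : Sym2 (Site 3), ω \ {e} ∈ percolatesAt (0 : Site 3)}

/-- The crux is literally `P_{p_c}(backboneEvent) = 0`. -/
theorem noBackbone_iff : NoBackbone ↔ μc.real backboneEvent = 0 := Iff.rfl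

/-- The cut-form TWO-ROUTE event at scale `r`: after every single-edge deletion the origin is still
joined by an open path to a site at sup-distance `≥ r`. -/
def twoRoute (r : ℕ) : Set (BondConfig (Site 3)) :=
  {ω | ∀ e : Sym2 (Site 3), ∃ y : Site 3, (∃ i : Fin 3, (r : ℤ) ≤ |y i|) ∧
    ω \ {e} ∈ openConn (0 : Site 3) y}

/-- The HALF-SPACE ONE-ARM event at scale `r`: the origin is joined inside `ℍ = {x | 0 ≤ x₀}` to a site
at sup-distance `≥ r` (verbatim the event `armH r` of the crux `QuantitativeBGN`). -/
def halfReach (r : ℕ) : Set (BondConfig (Site 3)) :=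
  {ω | ∃ y : Site 3, (∃ i : Fin 3, (r : ℤ) ≤ |y i|) ∧
    ω ∈ openConnIn {x : Site 3 | 0 ≤ x 0} 0 y}

/-! ## The two stub statements (spelled out over Literature declarations) -/

/-- STUB 1 statement: lossy surface domination of the critical two-route function, loss exponent
`κ < 1/2`. -/
def SurfaceDomination : Prop :=
  ∃ κ C : ℝ, κ < 1 / 2 ∧ ∀ r : ℕ, 1 ≤ r →
    (bondPercolation (zdGraph 3) (criticalProbI 3)).real
        {ω | ∀ e : Sym2 (Site 3), ∃ y : Site 3, (∃ i : Fin 3, (r : ℤ) ≤ |y i|) ∧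
          ω \ {e} ∈ openConn (0 : Site 3) y}
      ≤ C * (r : ℝ) ^ κ *
        (bondPercolation (zdGraph 3) (criticalProbI 3)).real
          {ω | ∃ y : Site 3, (∃ i : Fin 3, (r : ℤ) ≤ |y i|) ∧
            ω ∈ openConnIn {x : Site 3 | 0 ≤ x 0} 0 y}

/-- STUB 2 statement: quantitative Barsky–Grimmett–Newman at `p_c(ℤ³)` with exponent `a ≥ 1/2`. -/
def HalfSpaceArmExponent : Prop :=
  ∃ a C : ℝ, 1 / 2 ≤ a ∧ ∀ r : ℕ, 1 ≤ r →
    (bondPercolation (zdGraph 3) (criticalProbI 3)).real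
        {ω | ∃ y : Site 3, (∃ i : Fin 3, (r : ℤ) ≤ |y i|) ∧
          ω ∈ openConnIn {x : Site 3 | 0 ≤ x 0} 0 y}
      ≤ C * (r : ℝ) ^ (-a)

/-- `SurfaceDomination` in the local vocabulary. -/
theorem surfaceDomination_iff :
    SurfaceDomination ↔ ∃ κ C : ℝ, κ < 1 / 2 ∧ ∀ r : ℕ, 1 ≤ r →
      μc.real (twoRoute r) ≤ C * (r : ℝ) ^ κ * μc.real (halfReach r) := Iff.rfl

/-- `HalfSpaceArmExponent` in the local vocabulary. -/
theorem halfSpaceArmExponent_iff :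
    HalfSpaceArmExponent ↔ ∃ a C : ℝ, 1 / 2 ≤ a ∧ ∀ r : ℕ, 1 ≤ r →
      μc.real (halfReach r) ≤ C * (r : ℝ) ^ (-a) := Iff.rfl

/-! ## Registered stubs (the only `sorry`s of the file) -/

/-- **STUB 1 `surfaceDomination`** (XL, OPEN): there are `κ < 1/2` and `C` such that for every `r ≥ 1`,
`P_{p_c}(∀ e, ∃ y, ‖y‖∞ ≥ r ∧ 0 ↔ y in ω∖{e}) ≤ C · r^κ · P_{p_c}(∃ y, ‖y‖∞ ≥ r ∧ 0 ↔ y inside {x₀ ≥ 0})`.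
Why plausibly true: scaling exponents `x_B ≈ 1.13 > x_s ≈ 0.975`, i.e. the true `κ` is `≈ −0.16`
(margin `≈ 0.66`); BK gives only `Q_r ≤ P(0 ↔ ∂B(r))²`, useless in a jump world. Why it might fail:
false in a backboned jump world (as the crux); no `d = 3` tool compares two full-space arms with one
half-space arm. -/
theorem stub_surfaceDomination :
    ∃ κ C : ℝ, κ < 1 / 2 ∧ ∀ r : ℕ, 1 ≤ r →
      (bondPercolation (zdGraph 3) (criticalProbI 3)).real
          {ω | ∀ e : Sym2 (Site 3), ∃ y : Site 3, (∃ i : Fin 3, (r : ℤ) ≤ |y i|) ∧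
            ω \ {e} ∈ openConn (0 : Site 3) y}
        ≤ C * (r : ℝ) ^ κ *
          (bondPercolation (zdGraph 3) (criticalProbI 3)).real
            {ω | ∃ y : Site 3, (∃ i : Fin 3, (r : ℤ) ≤ |y i|) ∧
              ω ∈ openConnIn {x : Site 3 | 0 ≤ x 0} 0 y} := by
  sorry

/-- **STUB 2 `halfSpaceArmExponent`** (XL, OPEN): there are `a ≥ 1/2` and `C` such that for every
`r ≥ 1`, `P_{p_c}(∃ y, ‖y‖∞ ≥ r ∧ 0 ↔ y inside {x₀ ≥ 0}) ≤ C · r^{-a}` — quantitative BGN with exponent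
`≥ 1/2` (implies `QuantitativeBGN`, stmt-CriticalPhenomena-0913; admissible window `1/2 ≤ a ≤ 2` by the
landed `not_quantitativeBGNWith_of_two_lt`; numerically `a = x_s ≈ 0.96–0.98`). Why it might fail: not
false numerically, but OPEN with no tool: BGN's finite-size criterion yields no rate (Grimmett 1999 Thm
(7.35); Kozma–Nitzan 2024 §1(4)). -/
theorem stub_halfSpaceArmExponent :
    ∃ a C : ℝ, 1 / 2 ≤ a ∧ ∀ r : ℕ, 1 ≤ r →
      (bondPercolation (zdGraph 3) (criticalProbI 3)).real
          {ω | ∃ y : Site 3, (∃ i : Fin 3, (r : ℤ) ≤ |y i|) ∧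
            ω ∈ openConnIn {x : Site 3 | 0 ≤ x 0} 0 y}
        ≤ C * (r : ℝ) ^ (-a) := by
  sorry

/-! ### Name-keyed aliases of the stub statements
`__Registered.stub_X` is the statement of `stub_X` under the registered stub's short name, so that the
native skeleton audit (`#h21_check_skeleton`: hypotheses admissible iff registered obligations / declared
stubs BY NAME) accepts `NoBackbone_of : __Registered.stub_… → … → NoBackbone` (device of
`Cruxes/BGNOffTheFloor/Lines/birth.lean`; the `@[stub]` attribute is gate-reserved). -/
namespace __Registered

/-- Alias of `SurfaceDomination` keyed by the registered stub name. -/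
abbrev stub_surfaceDomination : Prop := SurfaceDomination
/-- Alias of `HalfSpaceArmExponent` keyed by the registered stub name. -/
abbrev stub_halfSpaceArmExponent : Prop := HalfSpaceArmExponent

end __Registered

/-! ## Proved plumbing -/

/-- The sup-norm box `{y | ‖y‖∞ < r}` of `ℤ³` is finite. -/
theorem finite_supBox (r : ℕ) : {y : Site 3 | ∀ i : Fin 3, |y i| < (r : ℤ)}.Finite := by
  refine (Set.Finite.pi (t := fun _ : Fin 3 => Set.Ioo (-(r : ℤ)) r) fun _ => Set.finite_Ioo _ _).subset ?_
  intro y hy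
  rw [Set.mem_univ_pi]
  exact fun i => abs_lt.1 (hy i)

/-- **Compactness inclusion**: a configuration in the crux event lies in every two-route event — for each
`e`, the infinite open cluster of `0` in `ω ∖ {e}` is not contained in the finite box `{‖y‖∞ < r}`. -/
theorem backboneEvent_subset_twoRoute (r : ℕ) : backboneEvent ⊆ twoRoute r := by
  intro ω hω e
  have hinf : (openCluster (ω \ {e}) (0 : Site 3)).Infinite := hω e
  obtain ⟨y, hyC, hybox⟩ := (hinf.sdiff (finite_supBox r)).nonempty
  refine ⟨y, ?_, hyC⟩
  simp only [Set.mem_setOf_eq, not_forall, not_lt] at hybox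
  exact hybox

/-- `Q(p_c) ≤ Q_r` for every scale `r`. -/
theorem real_backbone_le_twoRoute (r : ℕ) : μc.real backboneEvent ≤ μc.real (twoRoute r) :=
  measureReal_mono (backboneEvent_subset_twoRoute r)

/-- The two-route events are nested: reaching sup-distance `r + 1` reaches sup-distance `r`. -/
theorem twoRoute_antitone : Antitone twoRoute := by
  refine antitone_nat_of_succ_le fun r ω hω e => ?_
  obtain ⟨y, ⟨i, hi⟩, hy⟩ := hω e
  exact ⟨y, ⟨i, le_trans (by push_cast; linarith) hi⟩, hy⟩

/-- The constant of STUB 2 is non-negative (evaluate at `r = 1`). -/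
theorem const_nonneg_of_halfSpaceArmExponent {a C : ℝ}
    (h : ∀ r : ℕ, 1 ≤ r → μc.real (halfReach r) ≤ C * (r : ℝ) ^ (-a)) : 0 ≤ C := by
  have h1 := h 1 le_rfl
  simp only [Nat.cast_one, Real.one_rpow, mul_one] at h1
  exact measureReal_nonneg.trans h1

/-- **The budget**: the two stubs give a polynomial bound `Q(p_c) ≤ C · r^{-(a-κ)}` with `a − κ > 0`
for every `r ≥ 1`. -/
theorem real_backbone_le_rpow {κ C₁ a C₂ : ℝ}
    (h₁ : ∀ r : ℕ, 1 ≤ r → μc.real (twoRoute r) ≤ C₁ * (r : ℝ) ^ κ * μc.real (halfReach r))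
    (h₂ : ∀ r : ℕ, 1 ≤ r → μc.real (halfReach r) ≤ C₂ * (r : ℝ) ^ (-a)) :
    ∀ r : ℕ, 1 ≤ r → μc.real backboneEvent ≤ (max C₁ 0 * C₂) * (r : ℝ) ^ (-(a - κ)) := by
  intro r hr
  have hr0 : (0 : ℝ) < r := by exact_mod_cast hr
  have hrk : 0 ≤ (r : ℝ) ^ κ := Real.rpow_nonneg hr0.le κ
  have hH : 0 ≤ μc.real (halfReach r) := measureReal_nonneg
  have hexp : κ + -a = -(a - κ) := by ring
  calc μc.real backboneEvent ≤ μc.real (twoRoute r) := real_backbone_le_twoRoute r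
    _ ≤ C₁ * (r : ℝ) ^ κ * μc.real (halfReach r) := h₁ r hr
    _ ≤ max C₁ 0 * (r : ℝ) ^ κ * μc.real (halfReach r) :=
        mul_le_mul_of_nonneg_right (mul_le_mul_of_nonneg_right (le_max_left _ _) hrk) hH
    _ ≤ max C₁ 0 * (r : ℝ) ^ κ * (C₂ * (r : ℝ) ^ (-a)) :=
        mul_le_mul_of_nonneg_left (h₂ r hr) (mul_nonneg (le_max_right _ _) hrk)
    _ = (max C₁ 0 * C₂) * ((r : ℝ) ^ κ * (r : ℝ) ^ (-a)) := by ring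
    _ = (max C₁ 0 * C₂) * (r : ℝ) ^ (-(a - κ)) := by rw [← Real.rpow_add hr0, hexp]

/-! ## The composition, by name -/

/-- **`NoBackbone_of`**: the two registered stubs imply the crux
`Summit.CriticalPhenomena.PercolationContinuityZ3.Theses.PercNecklaceBackbone.NoBackbone`
(kernel-checked; no `sorry` outside the stubs). Proof: `Q(p_c) ≤ (max C₁ 0 · C₂) · r^{-(a-κ)}` for all
`r ≥ 1` (`real_backbone_le_rpow`), `a − κ > 1/2 − 1/2 = 0`, so the right side tends to `0`
(`tendsto_rpow_neg_atTop`) and `0 ≤ Q(p_c) ≤ 0`. -/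
theorem NoBackbone_of (h₁ : __Registered.stub_surfaceDomination)
    (h₂ : __Registered.stub_halfSpaceArmExponent) :
    Summit.CriticalPhenomena.PercolationContinuityZ3.Theses.PercNecklaceBackbone.NoBackbone := by
  obtain ⟨κ, C₁, hκ, h₁⟩ := h₁
  obtain ⟨a, C₂, ha, h₂⟩ := h₂
  rw [noBackbone_iff]
  have hs : 0 < a - κ := by linarith
  have hbound := real_backbone_le_rpow (κ := κ) (C₁ := C₁) (a := a) (C₂ := C₂) h₁ h₂
  have hlim : Tendsto (fun r : ℕ => (max C₁ 0 * C₂) * (r : ℝ) ^ (-(a - κ))) atTop (𝓝 0) := by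
    have h := ((tendsto_rpow_neg_atTop hs).comp tendsto_natCast_atTop_atTop).const_mul (max C₁ 0 * C₂)
    rw [mul_zero] at h
    exact h
  have hle : μc.real backboneEvent ≤ 0 :=
    ge_of_tendsto hlim (eventually_atTop.2 ⟨1, fun r hr => hbound r hr⟩)
  exact le_antisymm hle measureReal_nonneg

/-- Wiring check: the registered stubs feed `NoBackbone_of` as stated (an `example`, so no
`sorry`-tainted proof of the crux enters the environment). -/
example : Summit.CriticalPhenomena.PercolationContinuityZ3.Theses.PercNecklaceBackbone.NoBackbone :=
  NoBackbone_of stub_surfaceDomination stub_halfSpaceArmExponent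

/-! ## Honest-piece checks (informative) -/

/-- STUB 2 is at least the neighbouring crux `QuantitativeBGN` (stmt-CriticalPhenomena-0913), whose text is
`∃ a C, 0 < a ∧ ∀ r ≥ 1, P_{p_c}(armH r) ≤ C r^{-a}` with `armH r = halfReach r` verbatim. -/
theorem quantitativeBGN_shape_of_halfSpaceArmExponent (h : HalfSpaceArmExponent) :
    ∃ a C : ℝ, 0 < a ∧ ∀ r : ℕ, 1 ≤ r → μc.real (halfReach r) ≤ C * (r : ℝ) ^ (-a) := by
  obtain ⟨a, C, ha, h⟩ := h
  exact ⟨a, C, by linarith, h⟩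

end Summit.CriticalPhenomena.PercolationContinuityZ3.Cruxes.NoBackbone.Birth

end
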